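import Summits.BirchSwinnertonDyer.BirchSwinnertonDyer.Theorems.ResidualThetaTransportAtTwoThetaLayerLambdaCongruenceAtTwoCosocleRoad
import HarnessLib

/-!
# Crux Kan⁺ `ThetaLayerLambdaCongruenceAtTwo` (stmt-BirchSwinnertonDyer-20688), line `birth`: THE COSOCLE ROAD, part 2 —
# Kan⁺ BY NAME from cosocle multiplicity one at the mod-`2` eigen-ideals ALONE, and from ONE Buzzard-shaped fact read on the Picard side
# (width seat bsd-wall-rtt-p3-w3 g10; `--supports stmt-BirchSwinnertonDyer-20688`; THEOREMS ONLY — no `def`, no `sorry`; BSD is not proved)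

Part 1 (`…ThetaLayerLambdaCongruenceAtTwoCosocleRoad`): B4 from the cosocle count, (K2) `kTwo_of_dvd_of_mcCosocle` from {MC, cosocle count at
`𝔪₀`}, and `of_buzzardHypotheses` (the Galois-side hypotheses of Buzzard's Prop. 2.4 discharged at the eigen-ideal of a good-supersingular-at-`2`
curve for an arbitrary conclusion). THIS FILE:
* §4 the CURVE-LEVEL cosocle statement «`dim_{𝕋/𝔪} Λ/𝔪Λ = 2` at every mod-`2` eigen-ideal `𝔪` (`2 ∈ 𝔪`, `|𝕋/𝔪| = 2`, `T_q − a_q(W) ∈ 𝔪`) of a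
  good-supersingular-at-`2` curve `W` at an odd level `L` with all `p ∤ 2L` good» (hypothesis `hcosW`, Galois-free and pairing-free), supplied by
  `cosocleAtEigenIdeal_of_cosocleFact` from ONE fact of Buzzard's printed shape whose conclusion is read on `Hom(Λ, ℤ/2)` (hypothesis `hBzPic`,
  spelled inline — the statement of the Literature proposal `buzzard2000_multiplicityOne_gamma0_picard`; nothing here asserts it);
* §5 `kTwo_of_dvd_of_mcCosocleW`, `plusLineCharTwo_of_mcCosocleW` — (K2) and the plus line (C3k) from {MC, `hcosW`}, conclusions VERBATIM those of
  `kTwo_of_dvd_of_mcSdBz` / `plusLineCharTwo_of_mcSdBz`;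
* §6 **`thetaLayerLambdaCongruenceAtTwo_of_cosocleW_flatMuZeroAtTwo`**, **`thetaLayerLambdaCongruenceAtTwo_of_cosocleW : hcosW → Kan⁺`** (FLAT from the
  CLOSED node `CuspSpanEvenAtTwoOdd_proof`), **`thetaLayerLambdaCongruenceAtTwo_of_cosocleFact : hBzPic → Kan⁺`**.
So the floor of Kan⁺ becomes ONE published fact (Buzzard 2000 Prop. 2.4) once that fact is read on the carrier it is printed on; the Hecke
self-duality of `J₀(N)[2]` (item 27800, `heckeSelfDual_torsionBy_J0`) and the intersection pairing on `H₁(X₀(N); ℤ)`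
(`periodHomology_exists_heckeSelfAdjoint_perfectPairing`) are not used on this road.

WHY THE PICARD SIDE IS THE PRINTED SIDE. Buzzard, MRL 7 (2000) p. 100: «let `J(Γ)` denote its Jacobian. Let `T` be the Hecke algebra in
`End(J(Γ))` generated (via Picard functoriality) by the Hecke operators `T_n`». Model `J(Γ)(ℂ)` as the Picard torus
`Pic⁰(X)(ℂ) = H¹(X, 𝒪_X)/H¹(X; ℤ)` (exponential sequence; Birkenhake–Lange Prop. 5.2.3), on which pull-back along a correspondence `C` acts on the
lattice `H¹(X; ℤ) = Hom(H₁(X; ℤ), ℤ)` by `C^*`, the TRANSPOSE of the covariant `C_*` on `H₁(X; ℤ)`; so `J(Γ)[2] = ½H¹/H¹ = Hom(H₁(X; ℤ), ℤ/2)`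
with `T_n` acting by `χ ↦ χ ∘ (T_n)_*`. The tree's `Λ = periodHomology N` is `H₁(X₀(N); ℤ)` (B–L Lemma 4.1.1, DDT §1.3 p. 27) with the tree's
action `t • φ = φ ∘ T_n` = the covariant `(T_n)_*` (DDT p. 28 `ω_{T_p f} = Σ φ_i^* ω_f`, p. 32 «`T_p((E,P)) = Σ (E/C, P mod C)`»). Hence Buzzard's
`J(Γ₀(N))[𝔪] = {χ ∈ Hom(Λ, ℤ/2) : χ ∘ t = 0 (t ∈ 𝔪)} = Hom(Λ/𝔪Λ, ℤ/2)` and «`T/𝔪`-dimension `2`» is `dim_{𝕋/𝔪} Λ/𝔪Λ = 2`. The sibling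
fact `buzzard2000_multiplicityOne_gamma0` reads `J(Γ)(ℂ)` as the ALBANESE torus `S₂^∨/Λ = J0 N` (B–L §4.1 and Rem. 4.5.6; DDT Thm. 1.15), where
Picard functoriality is the Rosati-transposed action `t ↦ w_N t w_N` (B–L Prop. 4.6.3) and `J[2] = ½Λ/Λ ≅ Λ/2Λ`: the HOMOLOGICAL coordinate. The
two coordinates of `J[2]` are identified by the canonical principal polarisation `Alb ≅ Pic⁰` (B–L Prop. 5.2.6, §4.1.2), i.e. by Poincaré duality
= the Weil pairing = `heckeSelfDual_torsionBy_J0`; each reading alone is the printed statement transported through ONE standard coordinate.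

HONEST FRAMING: every theorem is CONDITIONAL on its displayed hypotheses; nothing closes an item; BSD is not proved by any of this.

References: Buzzard, MRL 7 (2000) Prop. 2.4, Def. 2.1–2.2 [Buzzard2000LevelLoweringModTwo]; Birkenhake–Lange, Complex Abelian Varieties,
Lemma 4.1.1, §4.1.2, Rem. 4.5.6, Prop. 4.6.3, Prop. 5.2.3, Prop. 5.2.6 [BirkenhakeLange2004]; Darmon–Diamond–Taylor (1995) §1.3 (pp. 27–28, 32),
Thm. 1.15 [DarmonDiamondTaylor1995]; Agashe–Ribet–Stein (2012) §3 [AgasheRibetStein2011]; Greenberg–Vatsal (2000) §3 [GreenbergVatsal2000];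
Pollack, Duke 118 (2003) Prop. 6.18 [Pollack2003]; Manin (1972) Thm. 1.9 [Manin1972].
-/

-- justification: the `Summit.BirchSwinnertonDyer.BirchSwinnertonDyer.…` path repeats a component (route-file convention)
set_option linter.dupNamespace false
set_option autoImplicit false

noncomputable section

open scoped MatrixGroups ComplexConjugate ModularForm NumberField Pointwise Classical
open CongruenceSubgroup Complex WeierstrassCurve IsDedekindDomain Polynomial Field Matrix Literature.NumberTheory.GaloisRepresentations
open Literature.NumberTheory.EllipticCurves Literature.NumberTheory.EllipticCurves.ModularForms
open Literature.NumberTheory.EllipticCurves.Rank1Residual Rat.HeightOneSpectrum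
open Summit.BirchSwinnertonDyer.BirchSwinnertonDyer.Theses.ResidualThetaTransportAtTwo

namespace Summit.BirchSwinnertonDyer.BirchSwinnertonDyer.Theorems.ThetaLayerLambdaCongruenceAtTwo

/-! ## §4 The curve-level cosocle statement, and its supply from a Buzzard-shaped fact read on the Picard side -/

/-- **Cosocle multiplicity one at the mod-`2` eigen-ideals of a good-supersingular-at-`2` curve, from ONE fact of Buzzard's printed shape
whose conclusion is read on `J₀(N)[2] = H¹(X₀(N); ℤ/2) = Hom(Λ, ℤ/2)`** (hypothesis `hBzPic`, spelled inline: hypothesis list = that of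
`buzzard2000_multiplicityOne_gamma0` VERBATIM, conclusion `dim_{𝕋/𝔪} Λ/𝔪Λ = 2` with `Λ = periodHomologyHecke N`; nothing here asserts it).
For `W` globally minimal with `GoodSS W 2`, `L` odd, all `p ∤ 2L` good, `𝔪 ∋ 2` maximal with `|𝕋/𝔪| = 2` and `T_q − a_q(W) ∈ 𝔪`
(`q ∤ L`): `dim_{𝕋/𝔪} Λ/𝔪Λ = 2`, by §3. [cite: Buzzard2000LevelLoweringModTwo, Prop. 2.4 and Def. 2.1–2.2 (p. 100–101)] -/
theorem cosocleAtEigenIdeal_of_cosocleFact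
    (hBzPic : ∀ (N : ℕ) [NeZero N], Odd N →
      ∀ (𝔪 : Ideal (HeckeRing0 N 2)), 𝔪.IsMaximal → (2 : HeckeRing0 N 2) ∈ 𝔪 →
      ∀ (k : Type) [Field k] [IsAlgClosed k] [TopologicalSpace k] [DiscreteTopology k]
        (ι : HeckeRing0 N 2 ⧸ 𝔪 →+* k) (ρ : ModPGaloisRep ℚ k 2),
        (∀ v : HeightOneSpectrum (𝓞 ℚ), ¬ ((primesEquiv v : Nat.Primes) : ℕ) ∣ 2 * N →
          ρ.IsUnramifiedAt v ∧
            ρ.HasFrobCharpolyAt v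
              (X ^ 2
                - C (ι (Ideal.Quotient.mk 𝔪 (HeckeRing0.T N 2
                    ((primesEquiv v : Nat.Primes) : ℕ) (primesEquiv v : Nat.Primes).2))) * X
                + C (((primesEquiv v : Nat.Primes) : ℕ) : k))) →
        FramedRep.IsIrreducible ρ →
        (∀ v : HeightOneSpectrum (𝓞 ℚ), ((primesEquiv v : Nat.Primes) : ℕ) = 2 →
          ∀ 𝔓 ∈ v.primesAbove, ∃ σ ∈ 𝔓.decompositionSubgroup (Field.absoluteGaloisGroup ℚ),
            ∀ c : k, ((ρ σ : GL (Fin 2) k) : Matrix (Fin 2) (Fin 2) k) ≠ Matrix.scalar (Fin 2) c) →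
        Module.finrank (HeckeRing0 N 2 ⧸ 𝔪)
          (periodHomologyHecke N ⧸ (𝔪 • ⊤ : Submodule (HeckeRing0 N 2) (periodHomologyHecke N))) = 2)
    : ∀ (W : WeierstrassCurve ℚ) [W.IsElliptic] [W.IsGloballyMinimal], GoodSS W 2 →
      ∀ (L : ℕ) [NeZero L], Odd L →
      (∀ v : HeightOneSpectrum (𝓞 ℚ), ¬ ((primesEquiv v : ℕ) ∣ 2 * L) → W.HasGoodReductionAt v) →
      ∀ (𝔪 : Ideal (HeckeRing0 L 2)), 𝔪.IsMaximal → (2 : HeckeRing0 L 2) ∈ 𝔪 → Nat.card (HeckeRing0 L 2 ⧸ 𝔪) = 2 →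
      (∀ (q : ℕ) (hq : q.Prime), ¬ q ∣ L → HeckeRing0.T L 2 q hq - (W.LFunction q : HeckeRing0 L 2) ∈ 𝔪) →
      Module.finrank (HeckeRing0 L 2 ⧸ 𝔪)
        (periodHomologyHecke L ⧸ (𝔪 • ⊤ : Submodule (HeckeRing0 L 2) (periodHomologyHecke L))) = 2 := by
  intro W _ _ hss L _ hL hgood 𝔪 h𝔪 h2 hq hT
  exact of_buzzardHypotheses W hss L hgood 𝔪 hq hT (hBzPic L hL 𝔪 h𝔪 h2)

/-! ## §5 (K2) and the plus line (C3k) from {MC} and the curve-level cosocle statement -/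

/-- (= `kTwo_of_dvd_of_mcSdBz` with {SD, Bz} replaced by the curve-level cosocle statement `hcosW`; statement otherwise VERBATIM.)
**(K2) at the crux's own level from {MC} and cosocle multiplicity one**: for `W` globally minimal, `GoodSS W 2`, `Δ_W < 0`, newform `f` of
level `N`, `S ≠ ∅` finite set of primes, `L` odd with `N·∏_{ℓ∈S} ℓ² ∣ L`, `primes(L) ⊆ S`, good reduction at every `p ∤ 2L`: every additive
`K ⊇ 2Λ, (T_q^∨ − a_q(W))Λ, U_ℓ^∨Λ,` cusp-negation differences has `x, y ∈ Λ ∖ K ⇒ x − y ∈ K`. (If `𝔪₀ = ⊤` the claim is vacuous;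
else `|𝕋/𝔪₀| = 2`, `𝔪₀` is maximal, and §2 applies with `hcosW` at `𝔪₀`.) [cite: DarmonDiamondTaylor1995, §4.1 (p. 107) and §4.5 (shape)] -/
theorem kTwo_of_dvd_of_mcCosocleW
    (hMC : IsNewformOf.exists_maninConstant_ne_zero)
    (hcosW : ∀ (W : WeierstrassCurve ℚ) [W.IsElliptic] [W.IsGloballyMinimal], GoodSS W 2 →
      ∀ (L : ℕ) [NeZero L], Odd L →
      (∀ v : HeightOneSpectrum (𝓞 ℚ), ¬ ((primesEquiv v : ℕ) ∣ 2 * L) → W.HasGoodReductionAt v) →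
      ∀ (𝔪 : Ideal (HeckeRing0 L 2)), 𝔪.IsMaximal → (2 : HeckeRing0 L 2) ∈ 𝔪 → Nat.card (HeckeRing0 L 2 ⧸ 𝔪) = 2 →
      (∀ (q : ℕ) (hq : q.Prime), ¬ q ∣ L → HeckeRing0.T L 2 q hq - (W.LFunction q : HeckeRing0 L 2) ∈ 𝔪) →
      Module.finrank (HeckeRing0 L 2 ⧸ 𝔪)
        (periodHomologyHecke L ⧸ (𝔪 • ⊤ : Submodule (HeckeRing0 L 2) (periodHomologyHecke L))) = 2)
    (W : WeierstrassCurve ℚ) [W.IsElliptic] [W.IsGloballyMinimal] (hss : GoodSS W 2) (hΔ : W.Δ < 0)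
    {N : ℕ} [NeZero N] {f : CuspForm (Gamma0 N) 2} (hf : IsNewformOf W f)
    (S : Finset ℕ) (hS : ∀ ℓ ∈ S, ℓ.Prime) (hSne : S.Nonempty)
    (L : ℕ) [NeZero L] (hL : Odd L) (hNL : N * ∏ ℓ ∈ S, ℓ ^ 2 ∣ L) (hLS : ∀ p : ℕ, p.Prime → p ∣ L → p ∈ S)
    (hgood : ∀ v : HeightOneSpectrum (𝓞 ℚ), ¬ ((primesEquiv v : ℕ) ∣ 2 * L) → W.HasGoodReductionAt v)
    (K : AddSubgroup (Module.Dual ℂ (CuspForm (Gamma0 L) 2)))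
    (h2K : ∀ x ∈ periodHomology L, (2 : ℂ) • x ∈ K)
    (hTK : ∀ (q : ℕ) (hq : q.Prime), ¬ q ∣ L → ∀ x ∈ periodHomology L,
      (haveI : NeZero q := ⟨hq.ne_zero⟩; heckeT (Gamma0 L) 2 q).dualMap x - (W.LFunction q : ℂ) • x ∈ K)
    (hUK : ∀ (q : ℕ) (hq : q.Prime), q ∣ L → ∀ x ∈ periodHomology L,
      (haveI : NeZero q := ⟨hq.ne_zero⟩; heckeT (Gamma0 L) 2 q).dualMap x ∈ K)
    (hcK : ∀ γ : Gamma0 L, periodFunctional L ⟨iotaConj (γ : SL(2, ℤ)), iotaConj_coe_mem_gamma0 γ⟩ - periodFunctional L γ ∈ K)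
    {x y : Module.Dual ℂ (CuspForm (Gamma0 L) 2)} (hx : x ∈ periodHomology L) (hy : y ∈ periodHomology L)
    (hxK : x ∉ K) (hyK : y ∉ K) : x - y ∈ K := by
  classical
  set G : Set (HeckeRing0 L 2) := {t : HeckeRing0 L 2 | t = 2 ∨ (∃ (q : ℕ) (hq : q.Prime), ¬ q ∣ L ∧
      t = HeckeRing0.T L 2 q hq - (W.LFunction q : HeckeRing0 L 2)) ∨ (∃ (q : ℕ) (hq : q.Prime), q ∣ L ∧
      t = HeckeRing0.T L 2 q hq)} with hGdef
  by_cases hne : Ideal.span G = ⊤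
  · -- vacuous case: `K ⊇ 𝔪₀Λ = Λ ∋ x`
    exfalso
    apply hxK
    have hK𝔪 : ∀ z ∈ Ideal.span G • periodHomologyHecke L, z ∈ K := by
      refine mem_of_mem_ideal_span_smul G K fun s hs z hz ↦ ?_
      rcases hs with rfl | ⟨q, hq', hqL, rfl⟩ | ⟨q, hq', hqL, rfl⟩
      · have : (2 : HeckeRing0 L 2) • z = (2 : ℂ) • z := by
          rw [show (2 : HeckeRing0 L 2) = ((2 : ℤ) : HeckeRing0 L 2) by norm_num, heckeRing0_intCast_smul, Int.cast_ofNat]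
        rw [this]
        exact h2K z hz
      · rw [sub_smul, heckeRing0_T_smul, heckeRing0_intCast_smul]
        exact hTK q hq' hqL z hz
      · rw [heckeRing0_T_smul]
        exact hUK q hq' hqL z hz
    apply hK𝔪
    rw [hne, Submodule.top_smul]
    exact (mem_periodHomologyHecke L).mpr hx
  · have h2 : (2 : HeckeRing0 L 2) ∈ Ideal.span G := Ideal.subset_span (Or.inl rfl)
    have hq := natCard_quotient_eq_two_of_ne_top (Ideal.span G) h2 (eigenIdeal_T_sub_int_mem W) hne
    haveI h𝔪 : (Ideal.span G).IsMaximal := isMaximal_of_natCard_quotient_eq_two _ hq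
    have hT : ∀ (q : ℕ) (hq' : q.Prime), ¬ q ∣ L →
        HeckeRing0.T L 2 q hq' - (W.LFunction q : HeckeRing0 L 2) ∈ Ideal.span G :=
      fun q hq' hqL ↦ Ideal.subset_span (Or.inr (Or.inl ⟨q, hq', hqL, rfl⟩))
    have hcos := hcosW W hss L hL hgood (Ideal.span G) h𝔪 h2 hq hT
    exact kTwo_of_dvd_of_mcCosocle hMC W hss hΔ hf S hS hSne L hNL hLS hcos K h2K hTK hUK hcK hx hy hxK hyK

/-- (= `plusLineCharTwo_of_mcSdBz` with {SD, Bz} replaced by the curve-level cosocle statement `hcosW`; CONCLUSION VERBATIM, so every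
consumer of the plus line — K1 `mazurTateCongruence_of_plusLine`, Kan⁺ `…_of_plusLineLevel_curveMax_nonRoot` — may swap it in.)
**(C3k) «plus multiplicity one over fields of characteristic `2`» at every level of the crux's shape, from {MC} and cosocle multiplicity one.**
For `W` globally minimal with `GoodSS W 2` and `Δ_W < 0`, an odd level `N'` with a newform `f` of `W` of level `N`, a nonempty finite set
of primes `S` with `N·∏_{ℓ∈S} ℓ² ∣ N'`, `primes(N') ⊆ S` and good reduction at every `p ∤ 2N'`: over every field `k` of characteristic
`2`, two nonzero even `1`-periodic Γ₀(N')-symbol functions that are exact Hecke eigenfunctions (`T_q ↦ a_q(W)`, `q ∤ N'`; `U_ℓ ↦ 0`,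
`ℓ ∣ N'`) are proportional. Proof: `plusLineCharTwo_of_kTwo` with (K2) = `kTwo_of_dvd_of_mcCosocleW`. BSD is not proved by this.
[cite: Manin1972, Thm. 1.9] [cite: DarmonDiamondTaylor1995, §4.5 (shape)] -/
theorem plusLineCharTwo_of_mcCosocleW
    (hMC : IsNewformOf.exists_maninConstant_ne_zero)
    (hcosW : ∀ (W : WeierstrassCurve ℚ) [W.IsElliptic] [W.IsGloballyMinimal], GoodSS W 2 →
      ∀ (L : ℕ) [NeZero L], Odd L →
      (∀ v : HeightOneSpectrum (𝓞 ℚ), ¬ ((primesEquiv v : ℕ) ∣ 2 * L) → W.HasGoodReductionAt v) →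
      ∀ (𝔪 : Ideal (HeckeRing0 L 2)), 𝔪.IsMaximal → (2 : HeckeRing0 L 2) ∈ 𝔪 → Nat.card (HeckeRing0 L 2 ⧸ 𝔪) = 2 →
      (∀ (q : ℕ) (hq : q.Prime), ¬ q ∣ L → HeckeRing0.T L 2 q hq - (W.LFunction q : HeckeRing0 L 2) ∈ 𝔪) →
      Module.finrank (HeckeRing0 L 2 ⧸ 𝔪)
        (periodHomologyHecke L ⧸ (𝔪 • ⊤ : Submodule (HeckeRing0 L 2) (periodHomologyHecke L))) = 2) :
    ∀ (W : WeierstrassCurve ℚ) [W.IsElliptic] [W.IsGloballyMinimal], GoodSS W 2 → W.Δ < 0 → ∀ (N' : ℕ), Odd N' →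
    ∀ {N : ℕ} [NeZero N] (f : CuspForm (Gamma0 N) 2), IsNewformOf W f →
    ∀ (S : Finset ℕ), (∀ ℓ ∈ S, ℓ.Prime) → S.Nonempty → N * ∏ ℓ ∈ S, ℓ ^ 2 ∣ N' → (∀ p : ℕ, p.Prime → p ∣ N' → p ∈ S) →
    (∀ v : HeightOneSpectrum (𝓞 ℚ), ¬ ((primesEquiv v : ℕ) ∣ 2 * N') → W.HasGoodReductionAt v) →
    ∀ (k : Type) [Field k] [CharP k 2] (Ψ₁ Ψ₂ : ℚ → k), (∀ (r : ℚ) (z : ℤ), Ψ₁ (r + z) = Ψ₁ r) → (∀ r : ℚ, Ψ₁ (-r) = Ψ₁ r) → (∀ (γ : CongruenceSubgroup.Gamma0 (N')) (r : ℚ), ((γ : SL(2, ℤ)) 1 0 : ℚ) * r + ((γ : SL(2, ℤ)) 1 1 : ℚ) ≠ 0 → Ψ₁ ((((γ : SL(2, ℤ)) 0 0 : ℚ) * r + ((γ : SL(2, ℤ)) 0 1 : ℚ)) / (((γ : SL(2, ℤ)) 1 0 : ℚ) * r + ((γ : SL(2, ℤ)) 1 1 : ℚ))) = (if ((γ : SL(2,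 ℤ)) 1 0) = 0 then 0 else Ψ₁ ((((γ : SL(2, ℤ)) 0 0 : ℚ)) / (((γ : SL(2, ℤ)) 1 0 : ℚ)))) + Ψ₁ r) → (∀ (r : ℚ) (z : ℤ), Ψ₂ (r + z) = Ψ₂ r) → (∀ r : ℚ, Ψ₂ (-r) = Ψ₂ r) → (∀ (γ : CongruenceSubgroup.Gamma0 (N')) (r : ℚ), ((γ : SL(2, ℤ)) 1 0 : ℚ) * r + ((γ : SL(2, ℤ)) 1 1 : ℚ) ≠ 0 → Ψ₂ ((((γ : SL(2, ℤ)) 0 0 : ℚ) * r + ((γ : SL(2, ℤ)) 0 1 : ℚ)) / (((γ : SL(2, ℤ)) 1 0 : ℚ) * r + ((γ : SL(2, ℤ)) 1 1 : ℚ))) = (if ((γ : SL(2, ℤ)) 1 0) = 0 then 0 else Ψ₂ ((((γ : SL(2, ℤ)) 0 0 : ℚ)) / (((γ : SL(2, ℤ)) 1 0 : ℚ)))) + Ψ₂ r) → (∃ r : ℚ, Ψ₁ r ≠ 0) → (∃ r : ℚ, Ψ₂ r ≠ 0) → (∀ q : ℕ, q.Prime → ¬ q ∣ N' → ∀ r :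 ℚ, (∑ j : Fin q, Ψ₁ ((r + j) / q)) + Ψ₁ (q * r) = (W.LFunction q : k) * Ψ₁ r) → (∀ q : ℕ, q.Prime → ¬ q ∣ N' → ∀ r : ℚ, (∑ j : Fin q, Ψ₂ ((r + j) / q)) + Ψ₂ (q * r) = (W.LFunction q : k) * Ψ₂ r) → (∀ ℓ : ℕ, ℓ.Prime → ℓ ∣ N' → ∀ r : ℚ, ∑ j : Fin ℓ, Ψ₁ ((r + j) / ℓ) = 0) → (∀ ℓ : ℕ, ℓ.Prime → ℓ ∣ N' → ∀ r : ℚ, ∑ j : Fin ℓ, Ψ₂ ((r + j) / ℓ) = 0) → ∃ c : k, ∀ r : ℚ, Ψ₂ r = c * Ψ₁ r := by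
  intro W _ _ hss hΔ N' hN' N _ f hf S hS hSne hNL hLS hgood k _ _ Ψ₁ Ψ₂ _ hev₁ hM₁ _ hev₂ hM₂ hne₁ _ hT₁ hT₂ hU₁ hU₂
  haveI : NeZero N' := ⟨by rintro rfl; exact (Nat.not_even_iff_odd.mpr hN') (Even.zero)⟩
  have ha2 : ((W.LFunction 2 : ℤ) : k) = 0 := by
    rw [LFunction_apply_prime_eq_frobeniusTrace W 2 hss.1]
    obtain ⟨m, hm⟩ := hss.2
    rw [hm]
    push_cast
    rw [CharTwo.two_eq_zero, zero_mul]
  exact plusLineCharTwo_of_kTwo hN' (fun n ↦ W.LFunction n) ha2 Ψ₁ Ψ₂ hev₁ hM₁ hev₂ hM₂ hne₁ hT₁ hT₂ hU₁ hU₂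
    (fun K h2K hTK hUK hcK x hx y hy hxK hyK ↦
      kTwo_of_dvd_of_mcCosocleW hMC hcosW W hss hΔ hf S hS hSne N' hN' hNL hLS hgood K h2K hTK hUK hcK hx hy hxK hyK)

/-! ## §6 Kan⁺ BY NAME from cosocle multiplicity one — no Hecke self-duality, no pairing -/

/-- **Kan⁺ `ThetaLayerLambdaCongruenceAtTwo` BY NAME from {cosocle multiplicity one at the mod-`2` eigen-ideals} + FLAT** (= w4 g0 / tp2-p1-w2 g5's
`thetaLayerLambdaCongruenceAtTwo_of_sdBz_flatMuZeroAtTwo` with the plus line `plusLineCharTwo_of_sdBz hSD hBz` replaced by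
`plusLineCharTwo_of_mcCosocleW exists_maninConstant_ne_zero_holds hcosW`; `hflat` VERBATIM). Conditional; BSD is not proved by this.
[cite: GreenbergVatsal2000, §1 (10) and Prop. (2.4) (shape)] [cite: Pollack2003, Conj. 6.3 and Prop. 6.18] -/
theorem thetaLayerLambdaCongruenceAtTwo_of_cosocleW_flatMuZeroAtTwo
    (hcosW : ∀ (W : WeierstrassCurve ℚ) [W.IsElliptic] [W.IsGloballyMinimal], GoodSS W 2 →
      ∀ (L : ℕ) [NeZero L], Odd L →
      (∀ v : HeightOneSpectrum (𝓞 ℚ), ¬ ((primesEquiv v : ℕ) ∣ 2 * L) → W.HasGoodReductionAt v) →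
      ∀ (𝔪 : Ideal (HeckeRing0 L 2)), 𝔪.IsMaximal → (2 : HeckeRing0 L 2) ∈ 𝔪 → Nat.card (HeckeRing0 L 2 ⧸ 𝔪) = 2 →
      (∀ (q : ℕ) (hq : q.Prime), ¬ q ∣ L → HeckeRing0.T L 2 q hq - (W.LFunction q : HeckeRing0 L 2) ∈ 𝔪) →
      Module.finrank (HeckeRing0 L 2 ⧸ 𝔪)
        (periodHomologyHecke L ⧸ (𝔪 • ⊤ : Submodule (HeckeRing0 L 2) (periodHomologyHecke L))) = 2)
    (hflat : ∀ (W : WeierstrassCurve ℚ) [W.IsElliptic] [W.IsGloballyMinimal], ¬ W.HasCM → W.analyticRank = 0 → Literature.NumberTheory.EllipticCurves.Rank1Residual.GoodSS W 2 → W.frobeniusTrace 2 = 0 → W.Δ < 0 → ∀ [NeZero (W.conductorNorm ℤ)] (f : CuspForm (CongruenceSubgroup.Gamma0 (W.conductorNorm ℤ)) 2), Literature.NumberTheory.EllipticCurves.ModularForms.IsNewformOf W f → ∀ (Lplus Lminus : Literature.NumberTheory.EllipticCurves.IwasawaAlgebra 2), Summit.BirchSwinnertonDyer.Rank1Residual.Supersingular.IsPollackPair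 f 2 Lplus Lminus → ¬ PowerSeries.C (2 : ℤ_[2]) ∣ Lminus) :
    ThetaLayerLambdaCongruenceAtTwo :=
  thetaLayerLambdaCongruenceAtTwo_of_plusLineLevel_curveMax_nonRoot
    (plusLineAtTwoLevel_of_charTwoLevel (plusLineCharTwo_of_mcCosocleW IsNewformOf.exists_maninConstant_ne_zero_holds hcosW))
    (stub_curveDepletedSymbolMaxAtTwoPowerCusp_of_flatMuZeroAtTwo hflat) partnerEulerFactorNonRoot

/-- **Kan⁺ `ThetaLayerLambdaCongruenceAtTwo` BY NAME from cosocle multiplicity one at the mod-`2` eigen-ideals ALONE**: FLAT is read off the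
CLOSED node item 27436 (`CuspSpanEvenAtTwoOdd_proof`, rtt-p3-w2 g5) in the cohomological normalisation
(`SignedMuAtTwo.flatMuZeroAtTwo_of_cuspSpanEvenAtTwoOdd`, rtt-p4 g7). The ONLY hypothesis is the Galois-free, pairing-free curve-level statement
`hcosW : dim_{𝕋/𝔪} Λ/𝔪Λ = 2` at the mod-`2` eigen-ideals of good-supersingular-at-`2` curves at odd levels. Conditional; BSD is not proved by this.
[cite: Pollack2003, Conj. 6.3 and Prop. 6.18] [cite: GreenbergVatsal2000, §3 (13)] -/
theorem thetaLayerLambdaCongruenceAtTwo_of_cosocleW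
    (hcosW : ∀ (W : WeierstrassCurve ℚ) [W.IsElliptic] [W.IsGloballyMinimal], GoodSS W 2 →
      ∀ (L : ℕ) [NeZero L], Odd L →
      (∀ v : HeightOneSpectrum (𝓞 ℚ), ¬ ((primesEquiv v : ℕ) ∣ 2 * L) → W.HasGoodReductionAt v) →
      ∀ (𝔪 : Ideal (HeckeRing0 L 2)), 𝔪.IsMaximal → (2 : HeckeRing0 L 2) ∈ 𝔪 → Nat.card (HeckeRing0 L 2 ⧸ 𝔪) = 2 →
      (∀ (q : ℕ) (hq : q.Prime), ¬ q ∣ L → HeckeRing0.T L 2 q hq - (W.LFunction q : HeckeRing0 L 2) ∈ 𝔪) →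
      Module.finrank (HeckeRing0 L 2 ⧸ 𝔪)
        (periodHomologyHecke L ⧸ (𝔪 • ⊤ : Submodule (HeckeRing0 L 2) (periodHomologyHecke L))) = 2) :
    ThetaLayerLambdaCongruenceAtTwo :=
  thetaLayerLambdaCongruenceAtTwo_of_cosocleW_flatMuZeroAtTwo hcosW
    (Summit.BirchSwinnertonDyer.BirchSwinnertonDyer.Theorems.SignedMuAtTwo.flatMuZeroAtTwo_of_cuspSpanEvenAtTwoOdd
      Summit.BirchSwinnertonDyer.BirchSwinnertonDyer.Theorems.CuspSpanEvenAtTwoOdd_proof)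

/-- **Kan⁺ `ThetaLayerLambdaCongruenceAtTwo` BY NAME from ONE fact of Buzzard's printed shape read on the Picard side** (`hBzPic`, spelled
inline; = the statement of the Literature proposal `buzzard2000_multiplicityOne_gamma0_picard`, so that `…_of_cosocleFact h` type-checks for
`h : buzzard2000_multiplicityOne_gamma0_picard` by unfolding). Trust base {Buzzard 2000 Prop. 2.4 read on `J₀(N)[2] = H¹(X₀(N); ℤ/2)`}: the
Hecke self-duality of `J₀(N)[2]` / the intersection pairing on `H₁(X₀(N); ℤ)` (items 27800 / the IP fact) are NOT used. Conditional on that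
one fact; BSD is not proved by this. [cite: Buzzard2000LevelLoweringModTwo, Prop. 2.4 and Def. 2.1–2.2 (p. 100–101)]
[cite: Pollack2003, Conj. 6.3 and Prop. 6.18] -/
theorem thetaLayerLambdaCongruenceAtTwo_of_cosocleFact
    (hBzPic : ∀ (N : ℕ) [NeZero N], Odd N →
      ∀ (𝔪 : Ideal (HeckeRing0 N 2)), 𝔪.IsMaximal → (2 : HeckeRing0 N 2) ∈ 𝔪 →
      ∀ (k : Type) [Field k] [IsAlgClosed k] [TopologicalSpace k] [DiscreteTopology k]
        (ι : HeckeRing0 N 2 ⧸ 𝔪 →+* k) (ρ : ModPGaloisRep ℚ k 2),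
        (∀ v : HeightOneSpectrum (𝓞 ℚ), ¬ ((primesEquiv v : Nat.Primes) : ℕ) ∣ 2 * N →
          ρ.IsUnramifiedAt v ∧
            ρ.HasFrobCharpolyAt v
              (X ^ 2
                - C (ι (Ideal.Quotient.mk 𝔪 (HeckeRing0.T N 2
                    ((primesEquiv v : Nat.Primes) : ℕ) (primesEquiv v : Nat.Primes).2))) * X
                + C (((primesEquiv v : Nat.Primes) : ℕ) : k))) →
        FramedRep.IsIrreducible ρ →
        (∀ v : HeightOneSpectrum (𝓞 ℚ), ((primesEquiv v : Nat.Primes) : ℕ) = 2 →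
          ∀ 𝔓 ∈ v.primesAbove, ∃ σ ∈ 𝔓.decompositionSubgroup (Field.absoluteGaloisGroup ℚ),
            ∀ c : k, ((ρ σ : GL (Fin 2) k) : Matrix (Fin 2) (Fin 2) k) ≠ Matrix.scalar (Fin 2) c) →
        Module.finrank (HeckeRing0 N 2 ⧸ 𝔪)
          (periodHomologyHecke N ⧸ (𝔪 • ⊤ : Submodule (HeckeRing0 N 2) (periodHomologyHecke N))) = 2) :
    ThetaLayerLambdaCongruenceAtTwo :=
  thetaLayerLambdaCongruenceAtTwo_of_cosocleW (cosocleAtEigenIdeal_of_cosocleFact hBzPic)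

end Summit.BirchSwinnertonDyer.BirchSwinnertonDyer.Theorems.ThetaLayerLambdaCongruenceAtTwo

end
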